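import Summits.KontsevichZagierPeriods.KontsevichZagierPeriods.Theorems.RootDecompRationalCubeDichotomyRankDescentP02

/-! # `RootDecompRationalCubeDichotomyRankDescentP03` — part 3/14 of the mechanical ≤400-line split of `RankDescent_v12_landing.lean` (sha256 00885b8b9882f02e…)
Source: decomp-kz lens-2 g13 `RankDescent_v12.lean` (HOME/decomp-kz-lens-2/g13/, sha256 00885b8b…; critic g5-18…g5-66 CLEARED as NODE v1–v12 for crux stmt-KontsevichZagierPeriods-26322 RationalCubePiKernelSingle: rank dichotomy single_of_fullRankGeTwo + RankLeOneKernel, de Rham-exact descent, linear-in-one-variable / hyperbola / Fermat–hyperbolic / conic classes, transport kit, Brieskorn module; writer g7 l.1222: «landing split §0–4 ∣ … ∣ §16 --supports 26322 endorsed»); `#print axioms` pins removed; landed by census-1 g9.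
Split by census-1 g9 `gen/splitlean.py`: scopes re-opened with their `open`/`variable`/`set_option` context; mathematics and declaration order unchanged. -/

noncomputable section
open MeasureTheory Set MvPolynomial
open Literature.NumberTheory.Transcendental
open Literature.NumberTheory.Transcendental.KZ
namespace Summit.KontsevichZagierPeriods.RootDecompRationalCubeDichotomy.Rung26322.RankDescent
variable {M : ℕ}

open MeasureTheory Set MvPolynomial in
open Literature.NumberTheory.Transcendental in
open Literature.NumberTheory.Transcendental.KZ in
/-- Any rational-shape representation of dimension `≤ 1` with value `0` is `≡ 0`. [cite: KontsevichZagier2001, §1.2] -/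
private theorem mem_relations_of_dim_le_one {n : ℕ} (hn : n ≤ 1) (q : IntegralRep n) (hq : q.IsRational)
    (h0 : q.value = 0) : of q ∈ relations := by
  have hZ := RFun.rel_of_eqOn_zero (T := (RFun.const 0 : RFun n)) fun x _ => by simp
  have hE : KZ.Equivalent q (RFun.const 0 : RFun n).rep :=
    Summit.KontsevichZagierPeriods.LowDimension.LowdimBaker0DimLeOne.lowdimBaker0DimLeOne_proof hn hn
      q (RFun.const 0 : RFun n).rep hq (isRational_rep _) (by rw [h0, value_const_zero])
  have : of q = (of q - of (RFun.const 0 : RFun n).rep) + of (RFun.const 0 : RFun n).rep := by abel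
  rw [this]
  exact KZ.relations.add_mem hE hZ

open MeasureTheory Set MvPolynomial in
open Literature.NumberTheory.Transcendental in
open Literature.NumberTheory.Transcendental.KZ in
/-- Soundness: congruent formal combinations have equal values. [cite: KontsevichZagier2001, §1.2] -/
private theorem eval_eq_of_sub_mem {x y : FormalRep} (h : x - y ∈ relations) : eval x = eval y := by
  have h' := relations_le_ker_eval_holds h
  rw [AddMonoidHom.mem_ker, map_sub] at h'
  exact sub_eq_zero.1 h'

/-- **Rank `≤ 1` descends to dimension one**: `[P/Q₁(ℓ)]` on `[0,1]^{n+1}` is congruent to a formal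
sum of rational representations on `[0,1]`. [cite: KontsevichZagier2001, §1.2 rules (1),(3)] -/
theorem rankLeOne_to_dim_one : ∀ (n : ℕ) (T : RFun (n + 1)), RankLeOneDen T.den →
    ∃ l : List (RFun 1), KZ.of T.rep - (l.map fun S => KZ.of S.rep).sum ∈ KZ.relations := by
  intro n
  induction n with
  | zero => intro T _; exact ⟨[T], by simp⟩
  | succ n ih =>
    intro T hT
    obtain ⟨v, hv, hQ⟩ := exists_dir_of_rankLeOne T.den hT
    obtain ⟨G, -, hrel⟩ := descent_rel T v hv hQ
    have hA : ∀ k, ∃ l : List (RFun 1),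
        KZ.of (faceHi T G (v k) k).rep - (l.map fun S => KZ.of S.rep).sum ∈ KZ.relations :=
      fun k => ih _ (rankLeOneDen_faceAt hT G (v k) k 1 zero_le_one_and)
    have hB : ∀ k, ∃ l : List (RFun 1),
        KZ.of (faceLo T G (v k) k).neg.rep - (l.map fun S => KZ.of S.rep).sum ∈ KZ.relations :=
      fun k => ih _ (rankLeOneDen_faceAt hT G (v k) k 0 le_rfl_and)
    choose lA hlA using hA
    choose lB hlB using hB
    refine ⟨(List.ofFn fun k => lA k ++ lB k).flatten, ?_⟩
    have hsum : (((List.ofFn fun k => lA k ++ lB k).flatten).map fun S => KZ.of S.rep).sum =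
        ∑ k, (((lA k).map fun S => KZ.of S.rep).sum + ((lB k).map fun S => KZ.of S.rep).sum) := by
      rw [List.map_flatten, List.sum_flatten, List.map_map, List.map_ofFn, List.sum_ofFn]
      refine Finset.sum_congr rfl fun k _ => ?_
      simp [List.map_append, List.sum_append]
    rw [hsum]
    have hneg : ∀ k, KZ.of (faceLo T G (v k) k).neg.rep + KZ.of (faceLo T G (v k) k).rep ∈
        KZ.relations := fun k => RFun.rel_neg _
    have heq : KZ.of T.rep - ∑ k, (((lA k).map fun S => KZ.of S.rep).sum +
        ((lB k).map fun S => KZ.of S.rep).sum) =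
        (KZ.of T.rep - ∑ k, (KZ.of (faceHi T G (v k) k).rep - KZ.of (faceLo T G (v k) k).rep)) +
        ∑ k, ((KZ.of (faceHi T G (v k) k).rep - ((lA k).map fun S => KZ.of S.rep).sum) +
          (KZ.of (faceLo T G (v k) k).neg.rep - ((lB k).map fun S => KZ.of S.rep).sum) -
          (KZ.of (faceLo T G (v k) k).neg.rep + KZ.of (faceLo T G (v k) k).rep)) := by
      simp only [Finset.sum_add_distrib, Finset.sum_sub_distrib]; abel
    rw [heq]
    exact add_mem hrel (sum_mem fun k _ => sub_mem (add_mem (hlA k) (hlB k)) (hneg k))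

/-- **Theorem I (engine form).** A cube representation `[ [0,1]^n, P/Q₁(ℓ) ]` with value `0` is
`≡ 0`: no power of `[π]` is needed. [cite: KontsevichZagier2001, §1.2] -/
theorem rep_mem_relations_of_rankLeOne : ∀ (n : ℕ) (T : RFun n), RankLeOneDen T.den →
    T.rep.value = 0 → KZ.of T.rep ∈ KZ.relations := by
  intro n
  cases n with
  | zero => intro T _ h0; exact rep_mem_relations_of_dim_le_one (Nat.zero_le 1) T h0
  | succ n =>
    intro T hT h0
    obtain ⟨l, hl⟩ := rankLeOne_to_dim_one n T hT
    have hU := rel_lsum l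
    have hval : (lsum l).rep.value = 0 := by
      rw [← eval_of, eval_eq_of_sub_mem hU, ← eval_eq_of_sub_mem hl, eval_of, h0]
    have hUm := rep_mem_relations_of_dim_le_one le_rfl (lsum l) hval
    have : KZ.of T.rep = (KZ.of T.rep - (l.map fun S => KZ.of S.rep).sum) -
        (KZ.of (lsum l).rep - (l.map fun S => KZ.of S.rep).sum) + KZ.of (lsum l).rep := by abel
    rw [this]
    exact add_mem (sub_mem hl hU) hUm

/-! ## §4 The pieces of the node and the glue to crux 26322 (by name) -/

/-- From the hypotheses of 26322: the regular rational function on the cube. [folklore] -/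
def cubeRFun {m : ℕ} (P Q : MvPolynomial (Fin m) ℚ)
    (hQ : ∀ z ∈ Set.pi Set.univ (fun _ : Fin m => Set.Icc (0:ℝ) 1), MvPolynomial.aeval z Q ≠ 0) :
    RFun m :=
  ⟨P, Q, fun x hx => hQ x (by rw [← KZ.cube_eq_pi]; exact hx)⟩

/-- `[q] − [cube, P/Q] ∈ relations` for a representation with the data of 26322. [folklore] -/
theorem of_sub_cubeRFun_mem {m : ℕ} (q : IntegralRep m) (P Q : MvPolynomial (Fin m) ℚ)
    (hd : q.domain = Set.pi Set.univ (fun _ : Fin m => Set.Icc (0:ℝ) 1))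
    (hQ : ∀ z ∈ Set.pi Set.univ (fun _ : Fin m => Set.Icc (0:ℝ) 1), MvPolynomial.aeval z Q ≠ 0)
    (hf : ∀ z ∈ Set.pi Set.univ (fun _ : Fin m => Set.Icc (0:ℝ) 1),
      q.integrand z = MvPolynomial.aeval z P / MvPolynomial.aeval z Q) :
    of q - of (cubeRFun P Q hQ).rep ∈ relations := by
  refine of_sub_of_mem_relations_of_eqOn ?_ fun z hz => ?_
  · rw [RFun.rep_domain, hd, KZ.cube_eq_pi]
  · rw [hd] at hz
    exact hf z hz

/-- KZ's rational shape from the hypotheses of 26322. [folklore] -/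
theorem isRational_of_hyps {m : ℕ} (q : IntegralRep m) (P Q : MvPolynomial (Fin m) ℚ)
    (hd : q.domain = Set.pi Set.univ (fun _ : Fin m => Set.Icc (0:ℝ) 1))
    (hQ : ∀ z ∈ Set.pi Set.univ (fun _ : Fin m => Set.Icc (0:ℝ) 1), MvPolynomial.aeval z Q ≠ 0)
    (hf : ∀ z ∈ Set.pi Set.univ (fun _ : Fin m => Set.Icc (0:ℝ) 1),
      q.integrand z = MvPolynomial.aeval z P / MvPolynomial.aeval z Q) : q.IsRational :=
  ⟨P, Q, fun z hz => hQ z (hd ▸ hz), fun z hz => hf z (hd ▸ hz)⟩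

/-- **SPECIAL PIECE (structured side, PROVED): `RankLeOneKernel`.** For every dimension `m`, every
rational cube representation `[ [0,1]^m, P/Q ]` whose denominator has rank `≤ 1`,
`Q = Q₁(c₀ + Σ cᵢ xᵢ)` with `Q₁ ∈ ℚ[t]` (i.e. `{Q = 0}` is a pencil of parallel hyperplanes defined
over `ℚ̄`), and whose value is `0`, is `≡ 0` in KZ's rules — with NO power of `[π]`
(the case `N = 0` of the conclusion of `RationalCubePiKernelSingle`). (source: KontsevichZagier2001, §1.2) -/
def RankLeOneKernel : Prop :=
  ∀ (m : ℕ) (q : IntegralRep m) (P Q : MvPolynomial (Fin m) ℚ) (Q₁ : Polynomial ℚ) (c₀ : ℚ)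
    (c : Fin m → ℚ), Q = Polynomial.aeval (C c₀ + ∑ i, C (c i) * X i) Q₁ →
    q.domain = Set.pi Set.univ (fun _ : Fin m => Set.Icc (0:ℝ) 1) →
    (∀ z ∈ Set.pi Set.univ (fun _ : Fin m => Set.Icc (0:ℝ) 1), MvPolynomial.aeval z Q ≠ 0) →
    (∀ z ∈ Set.pi Set.univ (fun _ : Fin m => Set.Icc (0:ℝ) 1),
      q.integrand z = MvPolynomial.aeval z P / MvPolynomial.aeval z Q) →
    q.value = 0 → of q ∈ relations

/-- **Theorem I: `RankLeOneKernel` holds.** [cite: KontsevichZagier2001, §1.2] -/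
theorem rankLeOneKernel_holds : RankLeOneKernel := by
  intro m q P Q Q₁ c₀ c hQ1 hd hQ hf h0
  have hqT := of_sub_cubeRFun_mem q P Q hd hQ hf
  have hval : (cubeRFun P Q hQ).rep.value = 0 := by
    rw [← eval_of, ← eval_eq_of_sub_mem hqT, eval_of, h0]
  have hT := rep_mem_relations_of_rankLeOne m (cubeRFun P Q hQ) ⟨Q₁, c₀, c, hQ1⟩ hval
  have : of q = (of q - of (cubeRFun P Q hQ).rep) + of (cubeRFun P Q hQ).rep := by abel
  rw [this]
  exact add_mem hqT hT

/-- **GENERIC PIECE (residual): `FullRankKernelGeTwo`.** Crux 26322 `RationalCubePiKernelSingle`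
restricted to dimension `m ≥ 2` and to denominators `Q` of FULL RANK: no non-zero rational direction
`v` with `Σ_k v_k ∂Q/∂x_k = 0` (no translation invariance; `{Q = 0}` is not a cylinder over a
lower-dimensional hypersurface). Verbatim the binders of 26322 plus the two extra hypotheses.
(source: KontsevichZagier2001, §1.2) -/
def FullRankKernelGeTwo : Prop :=
  ∀ (m : ℕ) (q : IntegralRep m) (P Q : MvPolynomial (Fin m) ℚ), 2 ≤ m →
    (∀ v : Fin m → ℚ, (∑ k, v k • MvPolynomial.pderiv k Q) = 0 → v = 0) →
    q.domain = Set.pi Set.univ (fun _ : Fin m => Set.Icc (0:ℝ) 1) →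
    (∀ z ∈ Set.pi Set.univ (fun _ : Fin m => Set.Icc (0:ℝ) 1), MvPolynomial.aeval z Q ≠ 0) →
    (∀ z ∈ Set.pi Set.univ (fun _ : Fin m => Set.Icc (0:ℝ) 1),
      q.integrand z = MvPolynomial.aeval z P / MvPolynomial.aeval z Q) →
    q.value = 0 →
    ∃ N : ℕ, (fun y : FormalRep => of piRep * y)^[N] (of q) ∈ relations

/-- The residual is (trivially) implied by the crux: it IS 26322 with two extra hypotheses. [folklore] -/
theorem fullRankKernelGeTwo_of_single
    (h : Summit.KontsevichZagierPeriods.KontsevichZagierPeriods.Theses.RootDecompRationalCubeDichotomy.RationalCubePiKernelSingle) :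
    FullRankKernelGeTwo :=
  fun m q P Q _ _ hd hQ hf h0 => h m q P Q hd hQ hf h0

/-- **Theorem II (exhaustion, PROVED): the full-rank residual implies crux 26322.** By induction on
the dimension: a rank-deficient denominator admits a kernel direction `v`, the transversal Stokes
descent writes `[q]` as a formal sum of face representations on `[0,1]^{m-1}`, which merge (rule 1)
into ONE rational cube representation of dimension `m − 1` with the same value; dimensions `≤ 1` are
decided by Baker (`KZ_≤1`, in the tree). [cite: KontsevichZagier2001, §1.2] -/
theorem single_of_fullRankGeTwo (h : FullRankKernelGeTwo) :
    Summit.KontsevichZagierPeriods.KontsevichZagierPeriods.Theses.RootDecompRationalCubeDichotomy.RationalCubePiKernelSingle := by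
  intro m
  induction m with
  | zero =>
    intro q P Q hd hQ hf h0
    exact ⟨0, mem_relations_of_dim_le_one (Nat.zero_le 1) q (isRational_of_hyps q P Q hd hQ hf) h0⟩
  | succ m ih =>
    intro q P Q hd hQ hf h0
    by_cases hfr : ∀ v : Fin (m + 1) → ℚ, (∑ k, v k • MvPolynomial.pderiv k Q) = 0 → v = 0
    · by_cases hm : 2 ≤ m + 1
      · exact h (m + 1) q P Q hm hfr hd hQ hf h0
      · exact ⟨0, mem_relations_of_dim_le_one (by omega) q (isRational_of_hyps q P Q hd hQ hf) h0⟩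
    · -- rank-deficient: descend along a kernel direction and merge on `[0,1]^m`
      obtain ⟨v, hvQ, hv⟩ : ∃ v : Fin (m + 1) → ℚ, (∑ k, v k • MvPolynomial.pderiv k Q) = 0 ∧ v ≠ 0 := by
        simpa using hfr
      set T : RFun (m + 1) := cubeRFun P Q hQ with hTdef
      have hQ' : dirD v T.den = 0 := by rw [dirD_apply]; exact hvQ
      obtain ⟨G, -, hrel⟩ := descent_rel T v hv hQ'
      set L : List (RFun m) :=
        (List.ofFn fun k => faceHi T G (v k) k) ++ List.ofFn fun k => (faceLo T G (v k) k).neg with hL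
      have hU := rel_lsum L
      have hLsum : (L.map fun S => KZ.of S.rep).sum =
          ∑ k, KZ.of (faceHi T G (v k) k).rep + ∑ k, KZ.of (faceLo T G (v k) k).neg.rep := by
        rw [hL, List.map_append, List.sum_append, List.map_ofFn, List.sum_ofFn, List.map_ofFn,
          List.sum_ofFn]
        rfl
      have hneg : ∀ k, KZ.of (faceLo T G (v k) k).neg.rep + KZ.of (faceLo T G (v k) k).rep ∈
          KZ.relations := fun k => RFun.rel_neg _
      have hTU : KZ.of T.rep - KZ.of (lsum L).rep ∈ KZ.relations := by
        have : KZ.of T.rep - KZ.of (lsum L).rep =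
            (KZ.of T.rep - ∑ k, (KZ.of (faceHi T G (v k) k).rep - KZ.of (faceLo T G (v k) k).rep)) -
            (KZ.of (lsum L).rep - (L.map fun S => KZ.of S.rep).sum) -
            ∑ k, (KZ.of (faceLo T G (v k) k).neg.rep + KZ.of (faceLo T G (v k) k).rep) := by
          rw [hLsum]; simp only [Finset.sum_add_distrib, Finset.sum_sub_distrib]; abel
        rw [this]
        exact sub_mem (sub_mem hrel hU) (sum_mem fun k _ => hneg k)
      have hqT := of_sub_cubeRFun_mem q P Q hd hQ hf
      have hval : (lsum L).rep.value = 0 := by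
        rw [← eval_of, ← eval_eq_of_sub_mem hTU, ← eval_eq_of_sub_mem hqT, eval_of, h0]
      obtain ⟨N, hN⟩ := ih (lsum L).rep (lsum L).num (lsum L).den
        (by rw [RFun.rep_domain, KZ.cube_eq_pi])
        (fun z hz => (lsum L).den_ne z (by rw [KZ.cube_eq_pi]; exact hz)) (fun z _ => rfl) hval
      refine ⟨N, ?_⟩
      have : of q = (of q - KZ.of T.rep) + ((KZ.of T.rep - KZ.of (lsum L).rep) + KZ.of (lsum L).rep) := by
        abel
      rw [this, iterate_piMul_add, iterate_piMul_add]
      exact add_mem (piRep_mul_iterate_mem_relations N hqT)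
        (add_mem (piRep_mul_iterate_mem_relations N hTU) hN)

/-- **The node, by name.** `RationalCubePiKernelSingle` (crux 26322 of route
`RootDecompRationalCubeDichotomy`) ⟸ `FullRankKernelGeTwo`. [cite: KontsevichZagier2001, §1.2] -/
theorem rationalCubePiKernelSingle_of_pieces (hG : FullRankKernelGeTwo) :
    Summit.KontsevichZagierPeriods.KontsevichZagierPeriods.Theses.RootDecompRationalCubeDichotomy.RationalCubePiKernelSingle :=
  single_of_fullRankGeTwo hG

/-! ## §5 (v2) de Rham–EXACT integrands descend: the Griffiths–Dwork axis of 26322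

The same lever with general potentials. If `P/Q · dx_1 ∧ … ∧ dx_m` is EXACT in the algebraic de Rham
complex of `ℚ[x, 1/Q]`, i.e. `P/Q = Σ_k ∂_k (G_k / Q^{s+1})` — as a polynomial identity
`P · Q^{s+1} = Σ_k (∂_k G_k · Q − (s+1) · G_k · ∂_k Q)` — then one Newton–Leibniz move per coordinate
gives `[q] ≡ Σ_k ([G_k/Q^{s+1}|_{x_k=1}] − [G_k/Q^{s+1}|_{x_k=0}])` on `[0,1]^{m-1}`: an EXACT class
carries no `m`-dimensional period, only boundary periods. Rank-deficient data are exact with `s = 0`,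
`G_k = v_k G` (`drExact_of_dirD`), so §1–§4 is the linear shadow of this section. The generic residual
shrinks to NON-EXACT data (`[P/Q dx] ≠ 0` in `H^m_dR(𝔸^m ∖ {Q=0})`, the "non-zero Griffiths–Dwork
class" of the item's why-might-fail), and the reduction is DIMENSION-LOCAL (graded form below). -/

/-- `P/Q · dx` is de Rham-exact with poles along `Q`, pole order `≤ s+1` of the potential:
`P · Q^{s+1} = Σ_k (∂_k G_k · Q − (s+1) G_k ∂_k Q)`. [folklore] -/
def DRExact {m : ℕ} (P Q : MvPolynomial (Fin m) ℚ) : Prop :=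
  ∃ (s : ℕ) (G : Fin m → MvPolynomial (Fin m) ℚ),
    P * Q ^ (s + 1) = ∑ k, (pderiv k (G k) * Q - C ((s : ℚ) + 1) * (G k * pderiv k Q))

/-- The potential `G_k / Q^{s+1}` with the denominator of `T`. [folklore] -/
def Wp (T : RFun M) (s : ℕ) (Gk : MvPolynomial (Fin M) ℚ) : RFun M :=
  ⟨Gk, T.den ^ (s + 1), fun x hx => by rw [map_pow]; exact pow_ne_zero _ (T.den_ne x hx)⟩

/-- Pointwise on the cube: `P/Q = Σ_k ∂_k (G_k/Q^{s+1})` from the exactness identity. [folklore] -/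
theorem fn_eq_sum_pd_exact (T : RFun M) (s : ℕ) (G : Fin M → MvPolynomial (Fin M) ℚ)
    (hid : T.num * T.den ^ (s + 1) =
      ∑ k, (pderiv k (G k) * T.den - C ((s : ℚ) + 1) * (G k * pderiv k T.den)))
    (x : Fin M → ℝ) (hx : x ∈ KZ.cube M) :
    T.fn x = ∑ k, ((Wp T s (G k)).pd k).fn x := by
  have hden : aeval x T.den ≠ 0 := T.den_ne x hx
  have hid' : aeval x T.num * aeval x T.den ^ (s + 1) =
      ∑ k, (aeval x (pderiv k (G k)) * aeval x T.den -
        ((s : ℝ) + 1) * (aeval x (G k) * aeval x (pderiv k T.den))) := by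
    have h := congrArg (aeval x) hid
    simp only [map_mul, map_pow, map_sum, map_sub, MvPolynomial.aeval_C, eq_ratCast, Rat.cast_add,
      Rat.cast_natCast, Rat.cast_one] at h
    exact h
  have hnum : ∀ k, ((Wp T s (G k)).pd k).fn x =
      (aeval x (pderiv k (G k)) * aeval x T.den ^ (s + 1) -
        aeval x (G k) * (((s : ℝ) + 1) * (aeval x T.den ^ s * aeval x (pderiv k T.den)))) /
        (aeval x T.den ^ (s + 1)) ^ 2 := by
    intro k
    show aeval x (pderiv k (G k) * T.den ^ (s + 1) - G k * pderiv k (T.den ^ (s + 1))) /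
        aeval x ((T.den ^ (s + 1)) ^ 2) = _
    rw [(pderiv k).leibniz_pow, add_tsub_cancel_right, smul_eq_mul, nsmul_eq_mul]
    simp only [map_sub, map_mul, map_pow, map_add, map_one, map_natCast, Nat.cast_add, Nat.cast_one]
  rw [Finset.sum_congr rfl fun k _ => hnum k, ← Finset.sum_div]
  have hsum : ∑ k, (aeval x (pderiv k (G k)) * aeval x T.den ^ (s + 1) -
      aeval x (G k) * (((s : ℝ) + 1) * (aeval x T.den ^ s * aeval x (pderiv k T.den)))) =
      aeval x T.den ^ s * (aeval x T.num * aeval x T.den ^ (s + 1)) := by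
    rw [hid', Finset.mul_sum]
    refine Finset.sum_congr rfl fun k _ => ?_
    ring
  rw [hsum, RFun.fn]
  field_simp
  ring

/-- **Exact descent**: `[P/Q] − Σ_k ([G_k/Q^{s+1}|_{x_k=1}] − [G_k/Q^{s+1}|_{x_k=0}]) ∈ relations`.
[cite: KontsevichZagier2001, §1.2 rule (3)] -/
theorem descent_rel_exact (T : RFun (M + 1)) (s : ℕ) (G : Fin (M + 1) → MvPolynomial (Fin (M + 1)) ℚ)
    (hid : T.num * T.den ^ (s + 1) =
      ∑ k, (pderiv k (G k) * T.den - C ((s : ℚ) + 1) * (G k * pderiv k T.den))) :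
    KZ.of T.rep - ∑ k, (KZ.of ((Wp T s (G k)).faceAt k 1 zero_le_one_and).rep -
      KZ.of ((Wp T s (G k)).faceAt k 0 le_rfl_and).rep) ∈ KZ.relations := by
  have h1 : KZ.of T.rep - ∑ k, KZ.of ((Wp T s (G k)).pd k).rep ∈ KZ.relations :=
    RFun.rel_sum Finset.univ (fun k => (Wp T s (G k)).pd k) T
      (fun x hx => fn_eq_sum_pd_exact T s G hid x hx)
  have h2 : ∑ k, (KZ.of ((Wp T s (G k)).pd k).rep -
      (KZ.of ((Wp T s (G k)).faceAt k 1 zero_le_one_and).rep -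
        KZ.of ((Wp T s (G k)).faceAt k 0 le_rfl_and).rep)) ∈ KZ.relations :=
    sum_mem fun k _ => RFun.stokesAt k (Wp T s (G k))
  have heq : KZ.of T.rep - ∑ k, (KZ.of ((Wp T s (G k)).faceAt k 1 zero_le_one_and).rep -
      KZ.of ((Wp T s (G k)).faceAt k 0 le_rfl_and).rep) =
      (KZ.of T.rep - ∑ k, KZ.of ((Wp T s (G k)).pd k).rep) +
      ∑ k, (KZ.of ((Wp T s (G k)).pd k).rep -
        (KZ.of ((Wp T s (G k)).faceAt k 1 zero_le_one_and).rep -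
          KZ.of ((Wp T s (G k)).faceAt k 0 le_rfl_and).rep)) := by
    simp only [Finset.sum_sub_distrib]; abel
  rw [heq]
  exact KZ.relations.add_mem h1 h2

/-- Rank-deficient ⟹ exact (`s = 0`, `G_k = v_k · G` with `D_v G = P`). [folklore] -/
theorem drExact_of_dirD {m : ℕ} {P Q : MvPolynomial (Fin m) ℚ} {v : Fin m → ℚ} (hv : v ≠ 0)
    (hQ : dirD v Q = 0) : DRExact P Q := by
  obtain ⟨G, hG⟩ := exists_dirD_eq v hv P
  refine ⟨0, fun k => C (v k) * G, ?_⟩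
  have h1 : ∑ k, (pderiv k (C (v k) * G) * Q - C (((0 : ℕ) : ℚ) + 1) * (C (v k) * G * pderiv k Q)) =
      dirD v G * Q - G * dirD v Q := by
    simp only [Nat.cast_zero, zero_add, C_1, one_mul, Derivation.leibniz, pderiv_C,
      smul_eq_mul, dirD_apply, MvPolynomial.smul_eq_C_mul, Finset.sum_mul, Finset.mul_sum,
      ← Finset.sum_sub_distrib]
    refine Finset.sum_congr rfl fun k _ => ?_
    ring
  rw [h1, hG, hQ, mul_zero, sub_zero, zero_add, pow_one]

/-- Contrapositive: NON-exact data have full rank. [folklore] -/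
theorem fullRank_of_not_drExact {m : ℕ} {P Q : MvPolynomial (Fin m) ℚ} (h : ¬ DRExact P Q)
    (v : Fin m → ℚ) (hv : (∑ k, v k • MvPolynomial.pderiv k Q) = 0) : v = 0 := by
  by_contra hne
  exact h (drExact_of_dirD hne (by rw [dirD_apply]; exact hv))

/-! ### The graded (dimension-local) pieces -/

end Summit.KontsevichZagierPeriods.RootDecompRationalCubeDichotomy.Rung26322.RankDescent
end
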